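import Summits.CriticalPhenomena.CardyFormulaZ2.Theorems.CardyMagicRigidityNestingRigidityFiveArmUpperNormalForm
import Literature.Probability.Percolation.ArmExponentsTwoArm
import HarnessLib
import Literature.Probability.Percolation.FiveArmExponentFacts

/-!
# Stub S5 `stub_fiveArmUpperT` of line `pinch-resampling` v3 (crux stmt-CriticalPhenomena-4835): the two published inputs, as named facts

Crux `Summit.CriticalPhenomena.CardyFormulaZ2.Theses.CardyMagicRigidity.NestingRigidity`, stub S5
`stub_fiveArmUpperT : FiveArmUpperT` — the two-radii five-arm upper bound
`P_{1/2}(armEvent (T,F,T,F,F) m n) ≤ C (m/n)²` on `𝕋` (`Theorems/CardyMagicRigidityPinchResamplingDefsV3.lean`),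
a PUBLISHED theorem absent from the tree.  Honest status of a proof inside the tree (audit of the
`j = 5` case of the separation programme): the tree PROVES the matching lower bound
(`fiveArm_lowerBound`, separation-free) and Nolin's arm separation / quasi-multiplicativity for
`j = 2` only (`Nolin2008_twoArm_separation_holds`, `Nolin2008_twoArm_quasiMult_holds`, 78 files); the
four-arm separation facts (`Nolin2008_fourArm_separation`, `Nolin2008_altFourArm_separation`,
`Nolin2008_adjFourArm_landing`) are still named facts, and nothing exists for five arms.  The
printed proofs of the UPPER bound at ONE radius are Nolin's (a landing sequence makes the black
five-arm site unique, "`A_v` can occur for at most one site `v`", then arms landing anywhere `≍` arms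
landing on `I`: five-arm separation) and Werner's exercise (exponential tail of the number `K` of
clusters crossing an annulus plus the planar lemma "at most two five-arm points on the joint
boundary of two clusters"), neither of which is in the tree; for TWO radii every proof glues at the
inner radius, i.e. uses five-arm quasi-multiplicativity (Prop. 17: arm separation).  So the stub is
landed CONDITIONALLY: this file VENDORS, as two named facts (`def … : Prop`; nothing is asserted, users take
them as hypotheses), the two printed statements of P. Nolin, EJP 13 (2008), from which
`FiveArmUpperT` follows by the sorry-free bookkeeping `fiveArmUpperT_of_pointBound_of_quasiMult`
(`…FiveArmUpperNormalForm.lean`, p150692) and the tree's lower bound: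

* `Nolin2008_thm24_fiveArm_upper` — §5.2 Thm. 24, five-arm item [arXiv 0711.4948 Thm. 23, third item],
  upper half, at every fixed inner radius, for every colour sequence of five arms taking both
  values (Kesten–Sidoravicius–Zhang 1998, Lemma 5 (3.7)–(3.8); Werner 2009, exercise sheet);
* `Nolin2008_prop17_quasiMult` — §4.5 Prop. 17 [arXiv Prop. 16], gluing half, at `p = 1/2`, for
  every colour sequence of every length (its `j = 2` instance is the tree's PROVED
  `Nolin2008_twoArm_quasiMult`, see `twoArm_quasiMult_of_prop17`);
* `fiveArmUpperT_of_nolin2008_facts : Literature.Probability.Percolation.Nolin2008_thm24_fiveArm_upper → Literature.Probability.Percolation.Nolin2008_prop17_quasiMult →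
  FiveArmUpperT` (and `fiveArmUpperT_of_nolin2008`, the same with the two statements expanded — the
  registered anchor); `pointUpperBound_of_fiveArmUpperT` — the converse sanity (the first fact, for
  `κ = (T,F,T,F,F)`, is implied back by the stub).

Typing conventions (order-free `armEvent`, hexagons for rhombi, `∀∃` thresholds) are those of the
library's existing arm-event facts (`NearCriticalFourArmFacts.lean`, `ArmExponentsTwoArm.lean`,
`ArmSeparation.lean`); each docstring says precisely how the recorded statement follows from the
printed one and carries a `TODO(general form)`.

References: P. Nolin, Near-critical percolation in two dimensions, EJP 13 (2008) 1562–1623, §4.1,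
§4.5 Prop. 17, §5.1 Prop. 20, §5.2 Thm. 24 [arXiv 0711.4948: Prop. 16, Prop. 19, Thm. 23; EJP number
= arXiv number + 1] [Nolin2008]; H. Kesten, V. Sidoravicius, Y. Zhang, Almost all words are seen in
critical site percolation on the triangular lattice, EJP 3 (1998), paper 10, Lemma 5
[KestenSidoraviciusZhang1998]; W. Werner, Lectures on two-dimensional critical percolation, PCMI 16
(2009), Lecture 6 §3 and first exercise sheet, "Five-arm exponent" [WernerPCMI2009]; O. Schramm,
J. Steif, Ann. Math. 171 (2010), Appendix A, last corollary (the `ℤ²` twin at two radii, "essentially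
due to [KSZ]") [SchrammSteif2010]; H. Kesten, CMP 109 (1987) [KestenScalingCMP1987].
-/

noncomputable section

namespace Summit.CriticalPhenomena.CardyFormulaZ2.Cruxes.NestingRigidity.PinchResampling

open MeasureTheory Literature.Probability.Percolation Literature.Probability.LatticeModels

/-! ## The two printed inputs, as named facts (nothing is asserted) -/

/-- **Stub S5, CONDITIONAL form (registered anchor of this file; the two hypotheses are, letter for
letter, the statements `Nolin2008_thm24_fiveArm_upper` and `Nolin2008_prop17_quasiMult`, expanded so
that the registered signature does not depend on where the gate files the two named facts):** the
two-radii five-arm upper bound `FiveArmUpperT` follows from Nolin's Thm. 24 (single radius) and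
Prop. 17 (quasi-multiplicativity) — instantiate both at `κ = (T,F,T,F,F)` and run the bookkeeping
`fiveArmUpperT_of_pointBound_of_quasiMult` (`…FiveArmUpperNormalForm.lean`, with the tree's lower
bound `fiveArm_lowerBound`). -/
theorem fiveArmUpperT_of_nolin2008 :
    (∀ κ : Fin 5 → Bool, (∃ i j, κ i ≠ κ j) → ∀ m : ℕ, 1 ≤ m → ∃ C : ℝ, ∀ n : ℕ, m ≤ n →
        polyArmProb κ m n ≤ C / (n : ℝ) ^ 2) →
      (∀ {k : ℕ} (κ : Fin k → Bool), ∃ c : ℝ, 0 < c ∧ ∃ n₀ : ℕ, ∀ n₁ n₂ n₃ : ℕ,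
        n₀ ≤ n₁ → n₁ < n₂ → n₂ < n₃ →
          c * (polyArmProb κ n₁ n₂ * polyArmProb κ n₂ n₃) ≤ polyArmProb κ n₁ n₃) →
      FiveArmUpperT := by
  intro h24 h17
  obtain ⟨c, hc, n₀, h⟩ := h17 ![true, false, true, false, false]
  exact fiveArmUpperT_of_pointBound_of_quasiMult
    (fun m hm => h24 _ ⟨0, 1, by decide⟩ m hm) ⟨c, hc, n₀, h⟩

/-- **Stub S5, CONDITIONAL form, by name:** `FiveArmUpperT` from the two named facts
`Nolin2008_thm24_fiveArm_upper` (Nolin 2008, Thm. 24, five-arm item, single radius, upper half)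
and `Nolin2008_prop17_quasiMult` (Prop. 17, gluing half, `p = 1/2`).  The trust base of
`stub_fiveArmUpperT` is exactly these two named facts (`fiveArmUpperT_of_nolin2008` unfolded). -/
theorem fiveArmUpperT_of_nolin2008_facts (h24 : Literature.Probability.Percolation.Nolin2008_thm24_fiveArm_upper)
    (h17 : Literature.Probability.Percolation.Nolin2008_prop17_quasiMult) : FiveArmUpperT :=
  fiveArmUpperT_of_nolin2008 h24 h17

/-- Sanity (no circularity in strength): conversely, the two-radii statement `FiveArmUpperT` gives
back the single-radius bound for its own colour sequence at every inner radius `m ≥ 1`, with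
`C(m) = C m²` (`fiveArmUpperT_iff_forall`). -/
theorem pointUpperBound_of_fiveArmUpperT (h : FiveArmUpperT) (m : ℕ) :
    ∃ C : ℝ, ∀ n : ℕ, m ≤ n →
      polyArmProb ![true, false, true, false, false] m n ≤ C / (n : ℝ) ^ 2 := by
  obtain ⟨C, hC⟩ := fiveArmUpperT_iff_forall.1 h
  refine ⟨C * (m : ℝ) ^ 2, fun n hmn => ?_⟩
  have := hC m n hmn
  calc polyArmProb ![true, false, true, false, false] m n
      ≤ C * ((m : ℝ) / n) ^ 2 := this
    _ = C * (m : ℝ) ^ 2 / (n : ℝ) ^ 2 := by rw [div_pow]; ring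

/-- Sanity: the `k = 2`, `κ = (T,F)` instance of `Nolin2008_prop17_quasiMult` is literally the
tree's named fact `Nolin2008_twoArm_quasiMult` (`critTwoArmProb = polyArmProb ![T,F]`), which is
PROVED in the tree (`Nolin2008_twoArm_quasiMult_holds`, `ArmSeparationFinalProofs.lean`). -/
theorem twoArm_quasiMult_of_prop17 (h : Literature.Probability.Percolation.Nolin2008_prop17_quasiMult) : Nolin2008_twoArm_quasiMult :=
  h ![true, false]

end Summit.CriticalPhenomena.CardyFormulaZ2.Cruxes.NestingRigidity.PinchResampling

end
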